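import Mathlib.Analysis.Complex.Basic
import Literature.Computability.AlgebraicComplexity.GCTObstructions
import Literature.Computability.AlgebraicComplexity.OrbitClosure
import HarnessLib

/-!
# Named fact: no occurrence obstructions for determinant vs padded permanent
(Bürgisser–Ikenmeyer–Panova 2019), fresh-padding corollary

Topic `Literature/Computability/AlgebraicComplexity`; cite item `wi-03852` (route
ValiantsHypothesis/GCTMult: the barrier fact), over the tree's `HasOccurrenceObstruction`
(`GCTObstructions.lean`), `detPoly` (`StandardFamilies.lean`) and `paddedPerPoly`
(`OrbitClosure.lean`).

**Bürgisser–Ikenmeyer–Panova, J. AMS 32 (2019), Thm. 1.1 (= arXiv:1604.06431v3 Thm. 1.4).** "Let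
`n, d, m` be positive integers with `n ≥ m²⁵` and `λ ⊢ nd`. If `λ` occurs in `ℂ[Z_{n,m}]`, then `λ`
also occurs in `ℂ[Ω_n]`." Here `Ω_n` is the orbit closure of `det_n` and `Z_{n,m}` that of the
padded permanent `X₁₁^{n-m} per_m ∈ Sym^n ℂ^{m²}` (§1(a): "For `n > m` we consider the padded
permanent defined as `X₁₁^{n-m} per_m ∈ Sym^n ℂ^{m²}`. (Sometimes the padding is achieved by using
a variable not appearing in `per_m`, but this is irrelevant, cf. [IP17].)"), the padding variable
`X₁₁` being ONE OF the `m²` variables of `per_m`; the proof runs on `ℓ(λ) ≤ m²` (Thm. 2.1 there).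

**The printed theorem lives downstream.** In the tree's module form it is
`Literature.Computability.Complexity.bip2019_not_hasOccurrenceObstruction`
(`Literature/Computability/Complexity/OccurrenceObstructionsBIP.lean`, over `bipPaddedPerPoly`:
top-left block padded by its corner variable; that file imports this one and documents the
discrepancy below), proved there and in `BIPNoOccurrenceModuleForm.lean` down to the weight-form
facts of BIP §5 (Props. 5.6(2), 5.8(2), Thm. 6.2).

**What this file records (provefact audit 2026-08-14).** The tree's `paddedPerPoly ℂ m n =
X₀₀^{n-m} · per_m(bottom-right block)` pads with a FRESH variable (`m² + 1` essential variables),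
so its orbit closure STRICTLY CONTAINS BIP's `Z_{n,m}`
(`BIPPaddingDegenerations.orbitClosure_bipPaddedPerPoly_subset`) and is contained in `Z_{n,m+1}`
(`BIPPaddingDegenerations.paddedPerPoly_mem_orbitClosure_bipPaddedPerPoly_succ`: kill the rest of
the corner row and expand). BIP's parenthetical "irrelevant" is the only printed comment on the
fresh padding and carries no constant: the printed theorem yields the fresh-padding statement for
`n ≥ (m+1)²⁵` (apply it at permanent size `m + 1`), and nothing printed covers the window
`m²⁵ ≤ n < (m+1)²⁵` (an earlier version of this file asserted the threshold `m²⁵` for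
`paddedPerPoly` as a cited fact; that was an unprinted strengthening and has been withdrawn). The
named fact below is therefore the COROLLARY form, threshold `(m+1)²⁵`; it is proved downstream,
modulo the named facts its proofs consume, twice:
`BIPPaddingDegenerations.not_hasOccurrenceObstruction_paddedPerPoly_of_succ` (from
`bip2019_not_hasOccurrenceObstruction` and the monotonicity of occurrence obstructions under
degeneration) and `BIPNoOccurrenceModuleForm.not_hasOccurrenceObstruction_paddedPerPoly_succ_of_parts`
(from BIP Props. 5.6(2), 5.8(2), Thm. 6.2, re-running BIP's assembly with `ℓ(λ) ≤ m² + 1`,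
`Literature.Computability.Complexity.no_occurrence_obstructions_succ`). Nothing asserted.

## References

* P. Bürgisser, C. Ikenmeyer, G. Panova, *No occurrence obstructions in geometric complexity
  theory*, J. Amer. Math. Soc. 32 (2019) 163–193 (arXiv:1604.06431v3, held text): §1(a) with
  (1.2) (the padded permanent and the parenthetical on fresh padding), Thm. 1.1 = arXiv Thm. 1.4,
  §6 (proof of Thm. 1.4: `m = 1` trivial; Kadish–Landsberg; Props. 6.1, 6.3).
  [BurgisserIkenmeyerPanova2019] (the key `BurgisserIkenmeyerPanovaJAMS2019` of the downstream
  files denotes the same paper).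
* C. Ikenmeyer, G. Panova, *Rectangular Kronecker coefficients and plethysms in geometric
  complexity theory*, Adv. Math. 319 (2017) (BIP's [IP17]; the Kronecker part).
* J. Dörfler, C. Ikenmeyer, G. Panova, *On geometric complexity theory: multiplicity obstructions
  are stronger than occurrence obstructions*, SIAM J. Appl. Algebra Geom. 4 (2020).
-/

noncomputable section

namespace Literature.Computability.AlgebraicComplexity

/-- NAMED FACT (**corollary of Bürgisser–Ikenmeyer–Panova 2019, Thm. 1.1 = arXiv v3 Thm. 1.4,
applied at permanent size `m + 1`**): for positive `m, d` and `n ≥ (m+1)²⁵` there is NO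
occurrence obstruction against `X₀₀^{n-m} per_m ∈ Δ[det_n]`, where, as in `paddedPerPoly`, the
padding variable `X₀₀` is NOT a variable of `per_m`: every irreducible `GL_{n²}(ℂ)`-representation
occurring in the degree-`d` piece of the coordinate ring of the orbit closure of this padded
permanent admits a nonzero intertwiner to that of `det_n`. The printed theorem concerns the padding
by a variable OF `per_m` and threshold `m²⁵` (module form
`Literature.Computability.Complexity.bip2019_not_hasOccurrenceObstruction`, `OccurrenceObstructionsBIP.lean`); since
`paddedPerPoly ℂ m n ∈ Z_{n,m+1}`, it implies the present statement, which is PROVED downstream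
(modulo the named facts consumed there) as
`BIPPaddingDegenerations.not_hasOccurrenceObstruction_paddedPerPoly_of_succ` and as
`BIPNoOccurrenceModuleForm.not_hasOccurrenceObstruction_paddedPerPoly_succ_of_parts`; the window
`m²⁵ ≤ n < (m+1)²⁵` is covered by no printed statement. Users take
`(h : bip_no_occurrence_obstruction_succ)`.
[cite: BurgisserIkenmeyerPanova2019, Thm. 1.1 (= arXiv:1604.06431v3 Thm. 1.4) applied at m+1, with §1(a) (corollary for the fresh padding variable)] -/
def bip_no_occurrence_obstruction_succ : Prop :=
  ∀ (m n d : ℕ) [NeZero n], 1 ≤ m → 1 ≤ d → (m + 1) ^ 25 ≤ n →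
    ¬ HasOccurrenceObstruction (detPoly (Fin n) ℂ) (paddedPerPoly ℂ m n) n d

/-- The barrier in the shape a GCT route consumes: at `n = (m+1)²⁵` (any `m ≥ 1`) occurrence
obstructions against the fresh-variable padded permanent are absent in every degree `d ≥ 1`, so an
occurrence-based proof of `dc̄(per_m) > (m+1)²⁵` is impossible. [Bürgisser–Ikenmeyer–Panova 2019,
Thm. 1.1 and §1(c)] [folklore] -/
theorem not_hasOccurrenceObstruction_succ_pow (h : bip_no_occurrence_obstruction_succ) {m : ℕ}
    (hm : 1 ≤ m) {d : ℕ} (hd : 1 ≤ d) :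
    ¬ HasOccurrenceObstruction (detPoly (Fin ((m + 1) ^ 25)) ℂ) (paddedPerPoly ℂ m ((m + 1) ^ 25))
      ((m + 1) ^ 25) d :=
  h m ((m + 1) ^ 25) d hm hd le_rfl

end Literature.Computability.AlgebraicComplexity
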